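/-
Copyright (c) 2026. All rights reserved.
Released under Apache 2.0 license as described in the file LICENSE.
Authors: abc-iut cell, prover seat abc-iut-L4-t15 (wave 2), over the statements of abc-iut-L4-t3; `⋉`-twin re-elaborated by prover seat abc-iut-L4-t11
(gen 15) per the cell recipe LTIMES-RECIPE (owner abc-iut-L4-t3), statements unchanged.
-/
import Literature.AnabelianGeometry.AbsoluteAnabelian.DiagramUniversalTelecores
import Literature.AnabelianGeometry.AbsoluteAnabelian.Ltimes.LogFrobeniusCoresProofs

/-!
# [AbsTopIII] Corollary 5.5 (ii): the telecore `𝔗_{An•}` — DISCHARGE of `LogFrobeniusSetting.Cor55Telecore`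

S. Mochizuki, *Topics in absolute anabelian geometry III: global reconstruction algorithms*,
J. Math. Sci. Univ. Tokyo 22 (2015) 939–1156 [MochizukiAbsTopIII2015]; locators `p.N` = pages of the author's
manuscript (`paper:url-5493eb38cbb7`), read on the page: Cor 5.5 (ii) pp. 130–131 ("The 'forgetful functor' `φ_{An•}`
gives rise to a telecore structure `𝔗_{An•}` on `D•_{≤5}`, whose underlying diagram of categories we denote by
`D_{An•}`, by appending to `D•_{≤6}` telecore edges [display] from the core `An•[𝒳]` to the various copies of `𝒳` in
`D•_{≤2}` given by copies of `φ_{An•}`, which we denote by `φ_⋏`, for `⋏ ∈ L†`"; "Then the collection of natural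
transformations `{η_{□⋎}, η_{□⋎}⁻¹, η_⋏, η_⋏⁻¹}_{⋎ ∈ L, ⋏ ∈ L†}` … generate a contact structure `ℋ_{An•}` on the telecore
`𝔗_{An•}`"), proof p. 132 l. 22–23 ("Assertions (i), (ii) are immediate from the definitions").

abc-iut-L4-t3's `LogFrobeniusCorollaries.lean` types Cor 5.5 (ii) as the named `Prop` fact
`LogFrobeniusSetting.Cor55Telecore L`: EXISTENCE, over SOME core structure of `D•_{≤6}` on `D•_{≤5}` with core vertex
`An•[𝒳]`, of a telecore (abc-iut-L4-t2's Def 3.5 (iv) `Telecore`) whose telecore edges are the printed ones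
(`TelecoreIdx`: one edge `φ_⋏` to each `𝒳_⋏`, `⋏ ∈ L ∪ {□}`) carrying copies of `φ_{An•}` (`telecoreFun`), admitting a
contact structure (the generating homotopies `η_{□⋎}, η_⋏^{±1}` are not pinned in the typed statement).  Here that fact
is PROVED for every setting `L` with `V(F_mod) ≠ ∅` (`cor55Telecore_holds`), by abc-iut-L4-t5's universal-family
toolkit `DiagramLifts` / `DiagramUniversalFamilies` / `DiagramUniversalTelecores` (`univTelecore`: a telecore with
`𝒥|_𝒮 = ℋ` from structure functors on the base diagram lying over the core category, the telecore edges lying over it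
too; contact structures = restrictions of the universal family) over abc-iut-L4-t12's `DiagramCores` (the same
telecore family is also available by decomposition, `DiagramTelecoreFamilies.teleFamily`, this seat):

* `holOver` / `holOverIso`: every holomorphic vertex of `D•` carries a structure functor over `An•[𝒳]` and every arrow
  of `D•` lies over `An•[𝒳]` (the mechanism of `LogFrobeniusCoresProofs.cor55Cores_holds`, Cor 5.5 (i), now as data);
* `φAnEquiv`, `πAnIsoInverse`, `telecoreEdgeIso`: the telecore edges lie over `An•[𝒳]` too — `φ_{An•} ⋙ π_{An•} ≅ 𝟭`,
  from the interface's `η_{An•} : π_{An•} ⋙ φ_{An•} ≅ 𝟭` and "`φ_{An•}` is an equivalence" (so `π_{An•} ≅ φ_{An•}⁻¹`);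
* `telecoreBase`: the structure functors on `D•_{≤5}`; `cor55Telecore_holds`: t5's `univTelecore` /
  `isContactStructure_restrictBoundary` with fully faithful vertex set `{An•[𝒳]}` (structure functor `𝟭`), and
  `reach_an` of `LogFrobeniusCoresProofs`.

`V(F_mod) ≠ ∅` is necessary, as for Cor 5.5 (i): the core clause already fails for `V(F_mod) = ∅`
(`not_cor55Telecore_of_isEmpty`, `cor55Telecore_iff_nonempty`).  NOT here: Cor 5.10 (iv)(b)(c) (`Cor510MonoTelecore`), whose typed contact clause
asks for the homotopies `η⊢_{v,ν}` between a path through `An⊢[𝒩⊢⊞]` and one avoiding it — genuine data of Prop 5.8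
(iv)/(vii), not formal.  Refereed pre-IUT material; OUR kernel check of a typed statement; no side taken on
[IUTchIII] Cor. 3.12.

**`⋉`-TWIN (cell row «LTIMES-SUCCESSOR», L4-lead m162; typing finding T3g9-F1).**  This file is the verbatim
re-elaboration of `LogFrobeniusTelecoreProofs.lean` over the successor interface `LogFrobeniusSettingLtimes`
(`Ltimes/LogFrobeniusCompatibility.lean`: `ι⊞_{v,ε}` indexed by the edges of `Γ⃗^⋉_v` at EVERY place, [AbsTopIII] Cor 5.5 (iii)
p. 131), produced by the cell recipe `LTIMES-RECIPE.md`: names carry over inside `namespace LogFrobeniusSettingLtimes`, the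
section variable is `Lt`, setting-independent declarations are NOT repeated (the originals are in scope), statements and
proofs are otherwise unchanged.  The original file over the frozen interface stays as it is.
-/

set_option autoImplicit false

universe u

open CategoryTheory Quiver

namespace Literature.AnabelianGeometry.AbsoluteAnabelian

namespace LogFrobeniusSettingLtimes

variable {Vmod : Type u} {isArc : Vmod → Bool} (Lt : LogFrobeniusSettingLtimes Vmod isArc)

/-! ## Structure functors of the holomorphic vertices over `An•[𝒳]` (as data) -/

/-- The structure functor of a holomorphic vertex of `D•⊢` over `An•[𝒳]`: the natural functors towards `ℰ•` followed by
`κ_{An•}`; the identity at `An•[𝒳]`; `κ₂⁻¹` at the `ℰ•` of row 7 (cf. `LogFrobeniusCoresProofs.cor55Cores_holds`).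
[cite: MochizukiAbsTopIII2015, Cor 5.5 (i) p.130] -/
noncomputable def holOver : (x : DVertex Vmod isArc) → x.IsHolomorphic → (x.categoryLtimes Lt ⥤ Lt.An)
  | .row1 _, _ => Lt.proj ⋙ Lt.κAn.functor
  | .core, _ => Lt.proj ⋙ Lt.κAn.functor
  | .nplus v, _ => (Lt.forget v ⋙ Lt.toE v) ⋙ Lt.κAn.functor
  | .nv v, _ => Lt.toE v ⋙ Lt.κAn.functor
  | .e5, _ => Lt.κAn.functor
  | .an, _ => 𝟭 Lt.An
  | .e7, _ => Lt.κAn₂.inverse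
  | .nmonoPlus _, h => False.elim h
  | .nmono _, h => False.elim h
  | .emono5, h => False.elim h
  | .anMono, h => False.elim h
  | .emono7, h => False.elim h

/-- Every arrow of `D•` lies over `An•[𝒳]`, by the interface's `logOver`, `lamOver` and the unit isomorphisms of
`κ_{An•}`, `κ₂` ("immediate from the definitions — cf. also the proofs of Corollary 3.6, (i)", p. 132).
[cite: MochizukiAbsTopIII2015, Cor 5.5 (i) p.132] -/
noncomputable def holOverIso : {a b : DVertex Vmod isArc} → (e : DEdge isArc a b) → (ha : a.IsHolomorphic) →
    (hb : b.IsHolomorphic) → (DEdge.functorLtimes Lt e ⋙ Lt.holOver b hb ≅ Lt.holOver a ha)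
  | _, _, .log _, _, _ => (Functor.associator _ _ _).symm ≪≫ Functor.isoWhiskerRight Lt.logOver Lt.κAn.functor
  | _, _, .toCore _, _, _ => Functor.leftUnitor _
  | _, _, .lam v ν _, _, _ =>
    (Functor.associator _ _ _).symm ≪≫ Functor.isoWhiskerRight (Lt.lamOver v ν) Lt.κAn.functor
  | _, _, .forget _, _, _ => (Functor.associator _ _ _).symm
  | _, _, .toE _, _, _ => Iso.refl _
  | _, _, .κAn, _, _ => Functor.rightUnitor _
  | _, _, .anToE, _, _ => Lt.κAn₂.unitIso.symm
  | _, _, .monoNplus _, _, hb => False.elim hb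
  | _, _, .monoN _, _, hb => False.elim hb
  | _, _, .monoE5, _, hb => False.elim hb
  | _, _, .monoAn, _, hb => False.elim hb
  | _, _, .monoE7, _, hb => False.elim hb
  | _, _, .forgetMono _, _, hb => False.elim hb
  | _, _, .toEmono _, _, hb => False.elim hb
  | _, _, .κAnMono, _, hb => False.elim hb
  | _, _, .anMonoToE, _, hb => False.elim hb

/-! ## The telecore edges `φ_⋏ = φ_{An•}` lie over `An•[𝒳]` -/

/-- `φ_{An•}` as an equivalence of categories (the interface records "`φ_{An•}` is an equivalence").
[cite: MochizukiAbsTopIII2015, Cor 5.5 p.130] -/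
noncomputable def φAnEquiv : Lt.An ≌ Lt.X :=
  @Functor.asEquivalence _ _ _ _ Lt.φAn Lt.φAn_isEquivalence

/-- `π_{An•} ≅ φ_{An•}⁻¹`: "`π_{An•} : 𝒳 → An•[𝒳]` for the quasi-inverse for `φ_{An•}` given by the composite of the
natural projection functor `𝒳 → ℰ•` with `κ_{An•}`", from `η_{An•} : φ_{An•} ∘ π_{An•} ⥲ id_𝒳`.
[cite: MochizukiAbsTopIII2015, Cor 5.5 p.130] -/
noncomputable def πAnIsoInverse : Lt.proj ⋙ Lt.κAn.functor ≅ (φAnEquiv Lt).inverse :=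
  Functor.isoWhiskerLeft (Lt.proj ⋙ Lt.κAn.functor) (φAnEquiv Lt).unitIso ≪≫
    Functor.isoWhiskerRight Lt.ηAn (φAnEquiv Lt).inverse

/-- The telecore edges lie over `An•[𝒳]`: `φ_{An•} ⋙ π_{An•} ≅ 𝟭` (the other triangle of the quasi-inverse pair
`φ_{An•}, π_{An•}`). [cite: MochizukiAbsTopIII2015, Cor 5.5 (ii) p.130] -/
noncomputable def telecoreEdgeIso : Lt.φAn ⋙ (Lt.proj ⋙ Lt.κAn.functor) ≅ 𝟭 Lt.An :=
  Functor.isoWhiskerLeft Lt.φAn (πAnIsoInverse Lt) ≪≫ (φAnEquiv Lt).unitIso.symm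

/-! ## The telecore `𝔗_{An•}` over `D•_{≤5} ∪ {An•[𝒳]}` -/

/-- The structure functors of `D•_{≤5}` over `An•[𝒳]` (abc-iut-L4-t12's `OverData`): `holOver` at the vertices,
`holOverIso` at the arrows. [cite: MochizukiAbsTopIII2015, Cor 5.5 (i) p.130] -/
noncomputable def telecoreBase : (Lt.subdiagram (DVertex.InFirstRows 5)).OverData Lt.An where
  N a := Lt.holOver a.1 a.2.1
  μ {a b} e := Lt.holOverIso e a.2.1 b.2.1

/-- The observation edge `κ_{An•} : ℰ• → An•[𝒳]` lies over `An•[𝒳]` (through the structure functor `𝟭` at the core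
vertex). [cite: MochizukiAbsTopIII2015, Cor 5.5 (i) p.130] -/
noncomputable def obsEdgeIso : ∀ (a : DSub (DVertex.InFirstRows (Vmod := Vmod) (isArc := isArc) 5))
    (i : DEdge isArc a.1 .an), DEdge.functorLtimes Lt i ⋙ 𝟭 Lt.An ≅ Lt.telecoreBase.N a
  | ⟨_, _⟩, .κAn => Functor.rightUnitor _

/-- The telecore edges `φ_⋏`, `⋏ ∈ L ∪ {□}`, lie over `An•[𝒳]`: `φ_{An•} ⋙ π_{An•} ≅ 𝟭`.
[cite: MochizukiAbsTopIII2015, Cor 5.5 (ii) p.130] -/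
noncomputable def telEdgeIso : ∀ (a : DSub (DVertex.InFirstRows (Vmod := Vmod) (isArc := isArc) 5))
    (j : TelecoreIdx a.1), Lt.telecoreFun a.1 j ⋙ Lt.telecoreBase.N a ≅ 𝟭 Lt.An
  | ⟨.row1 _, _⟩, _ => telecoreEdgeIso Lt
  | ⟨.core, _⟩, _ => telecoreEdgeIso Lt
  | ⟨.nplus _, _⟩, j => PEmpty.elim j
  | ⟨.nv _, _⟩, j => PEmpty.elim j
  | ⟨.e5, _⟩, j => PEmpty.elim j
  | ⟨.an, _⟩, j => PEmpty.elim j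
  | ⟨.e7, _⟩, j => PEmpty.elim j
  | ⟨.nmonoPlus _, _⟩, j => PEmpty.elim j
  | ⟨.nmono _, _⟩, j => PEmpty.elim j
  | ⟨.emono5, _⟩, j => PEmpty.elim j
  | ⟨.anMono, _⟩, j => PEmpty.elim j
  | ⟨.emono7, _⟩, j => PEmpty.elim j

variable [Nonempty Vmod]

/-- **Cor 5.5 (ii) DISCHARGED** for every log-Frobenius setting `L` with `V(F_mod) ≠ ∅`: over the structure-functor
core of `D•_{≤6}` on `D•_{≤5}` (core vertex `An•[𝒳]`), the forgetful functor `φ_{An•}` gives a TELECORE `𝔗_{An•}` —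
telecore edges `φ_⋏ : An•[𝒳] → 𝒳_⋏`, `⋏ ∈ L ∪ {□}`, all carrying `φ_{An•}`, family `𝒥` = the universal homotopies on the
pairs `([γ₃]∘[γ₁], [γ₃]∘[γ₂])` of Def 3.5 (iv) (b) — together with a contact structure (a restriction of the universal
family). [cite: MochizukiAbsTopIII2015, Cor 5.5 (ii) pp.130–131] -/
theorem cor55Telecore_holds : Lt.Cor55Telecore := by
  let X : ExtShape.{u} (DSub (DVertex.InFirstRows (Vmod := Vmod) (isArc := isArc) 5)) :=
    obsShape (DVertex.InFirstRows 5) DVertex.an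
  have hreach : ∀ a : DSub (DVertex.InFirstRows (Vmod := Vmod) (isArc := isArc) 5), Nonempty (Path (X.base a) X.obs) :=
    reach_an
  have hW : ∀ w : (⟨X.I, fun a => TelecoreIdx a.1⟩ : ExtShape.{u} _).Vertex, w = ExtShape.obs _ →
      ((DiagramOfCategories.teleOver X (Lt.obsExt (DVertex.InFirstRows 5) DVertex.an) Lt.telecoreBase (𝟭 Lt.An)
        Lt.obsEdgeIso (fun a => TelecoreIdx a.1) (fun {a} j => Lt.telecoreFun a.1 j) Lt.telEdgeIso).N w).FullyFaithful := by
    rintro w rfl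
    exact Functor.FullyFaithful.id Lt.An
  exact ⟨_, _,
    DiagramOfCategories.univCoreObs_isCore X (fun _ => (inferInstance : IsEmpty PEmpty.{u + 1}))
      (Lt.obsExt (DVertex.InFirstRows 5) DVertex.an) Lt.telecoreBase (𝟭 Lt.An) Lt.obsEdgeIso
      (Functor.FullyFaithful.id Lt.An) hreach,
    DiagramOfCategories.univTelecore X (fun _ => (inferInstance : IsEmpty PEmpty.{u + 1}))
      (Lt.obsExt (DVertex.InFirstRows 5) DVertex.an) Lt.telecoreBase (𝟭 Lt.An) Lt.obsEdgeIso
      (Functor.FullyFaithful.id Lt.An) (fun a => TelecoreIdx a.1) (fun {a} j => Lt.telecoreFun a.1 j) Lt.telEdgeIso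
      (· = ExtShape.obs _) hW rfl hreach,
    rfl, HEq.rfl,
    ⟨_, DiagramOfCategories.isContactStructure_restrictBoundary X (fun _ => (inferInstance : IsEmpty PEmpty.{u + 1}))
      (Lt.obsExt (DVertex.InFirstRows 5) DVertex.an) Lt.telecoreBase (𝟭 Lt.An) Lt.obsEdgeIso
      (Functor.FullyFaithful.id Lt.An) (fun a => TelecoreIdx a.1) (fun {a} j => Lt.telecoreFun a.1 j) Lt.telEdgeIso
      (· = ExtShape.obs _) hW rfl hreach _ (DiagramOfCategories.isSaturated_univE _)
      (DiagramOfCategories.univE_obs_subset X (Lt.obsExt (DVertex.InFirstRows 5) DVertex.an) Lt.telecoreBase (𝟭 Lt.An)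
        Lt.obsEdgeIso (fun a => TelecoreIdx a.1) (fun {a} j => Lt.telecoreFun a.1 j) Lt.telEdgeIso
        (· = ExtShape.obs _) hW rfl)⟩⟩

end LogFrobeniusSettingLtimes

/-! ## The degenerate corner `V(F_mod) = ∅` -/

namespace LogFrobeniusSettingLtimes

variable {Vmod : Type u} {isArc : Vmod → Bool} (Lt : LogFrobeniusSettingLtimes Vmod isArc)

/-- **`V(F_mod) ≠ ∅` is necessary** for `Cor55Telecore` as typed: its core clause asks every vertex of `D•_{≤5}` to
reach `An•[𝒳]`, which `□` cannot do when `Vmod` is empty (cf. `not_cor55Cores_of_isEmpty`).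
[cite: MochizukiAbsTopIII2015, Cor 5.5 (ii) p.130] -/
theorem not_cor55Telecore_of_isEmpty [IsEmpty Vmod] : ¬ Lt.Cor55Telecore := by
  rintro ⟨H, hH, hcore, -⟩
  have hc : DVertex.InFirstRows (Vmod := Vmod) (isArc := isArc) 5 .core := ⟨trivial, by simp [DVertex.row]⟩
  obtain ⟨p⟩ := hcore.reaches_obs ⟨.core, hc⟩
  have h := eq_core_of_path_of_isEmpty (P := DVertex.InFirstRows 5) hc (x := .an) (fun i => by cases i) p
  change ExtVertex.obs = ExtVertex.base _ at h
  cases h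

/-- `Cor55Telecore L` holds if and only if `V(F_mod)` is nonempty. [cite: MochizukiAbsTopIII2015, Cor 5.5 (ii) p.130] -/
theorem cor55Telecore_iff_nonempty : Lt.Cor55Telecore ↔ Nonempty Vmod := by
  refine ⟨fun h => ?_, fun _ => Lt.cor55Telecore_holds⟩
  by_contra hV
  rw [not_nonempty_iff] at hV
  exact Lt.not_cor55Telecore_of_isEmpty h

end LogFrobeniusSettingLtimes

end Literature.AnabelianGeometry.AbsoluteAnabelian
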